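import Mathlib

/-!
# `Balaban1983to89.B12Localization41` — [Balaban1987RG1] (4.1) p. 281: the localisation identity
(binomial expansion of the symmetric `n`-linear form `δⁿE^{(j)}` at `B = ζ̃_□B + (1 − ζ̃_□)B`), PROVED

HONEST FRAMING (cell `lit-balaban`, verbatim): statement-level skeleton of published theorems with citation tags; proofs where landed; nothing here is a claim about the Yang–Mills mass gap.

CITATION HEADER.  T. Bałaban, *Renormalization group approach to lattice gauge field theories. I. Generation of
effective actions in a small field approximation and a coupling constant renormalization in four dimensions*,
Commun. Math. Phys. **109** (1987) 249–301, doi:10.1007/bf01215223 [Balaban1987RG1] (cell paper B12; held text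
`paper:balaban1987-cmp109-rg-i-small-field`, journal page = PDF page + 248; (4.1) read from the page render
`b2b-balaban-ref1/pages/1987-cmp109-rg-I-small-field/…-p033-x2.png`, p. 281 — the OCR layer of this display is
unusable).  Unit `lit-balaban-r09` gen 2 (Phase 2), SKELETON row `B12.Eq4.1` (kind C; v2.4 status `absent
(support only: B12Repr43.args45, B12Ineq45.Data45)` per REFEREE-3 — this file types AND proves the identity).

WHAT IS PRINTED (verbatim, p. 281, opening of Sect. 4 «Ward-Takahashi Identities and Their Consequences»).
*«Let us consider the sum on the right-hand side of (3.34). We can still separate some terms which are very small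
due to the exponential decay. It is convenient to localize the configuration B in a neighborhood of the cube □̃³,
hence we write*
  `⟨(δⁿ/δBⁿ) E^{(j)}(X, U_j(□₀, 1)), ⊗ⁿ B⟩`
  `  = Σ_{m=0}^{n} (n choose m) ⟨(δⁿ/δBⁿ) E^{(j)}(X, U_j(□₀, 1)), (⊗^{m} ζ̃_□B) ⊗ (⊗^{n−m} (1 − ζ̃_□)B)⟩,   (4.1)`
*where the function ζ̃_□ was introduced in the previous section [see the definition after (3.20)]. Terms with
m < n are exponentially small in L^jη.»*

WHAT THIS MODULE PROVES (kernel-checked; no `Prop` fact, no carrier re-declared).  (4.1) is the binomial theorem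
for a SYMMETRIC `n`-linear form evaluated on the diagonal `⊗ⁿB` with `B = B₁ + B₂`, `B₁ = ζ̃_□B`,
`B₂ = (1 − ζ̃_□)B`; the `n`-th variational derivative `δⁿE/δBⁿ` at a point is symmetric (E analytic, (3.36) ff.).
* `splitVec m a b = (a, …, a, b, …, b)` (`m` copies of `a` first) — the argument `(⊗^m a) ⊗ (⊗^{n−m} b)`.
* `piecewise_comp_perm_eq_splitVec` — for every `s ⊆ {1,…,n}` a permutation carries `s.piecewise a b` to
  `splitVec |s| a b` (Mathlib `Equiv.Perm.exists_map_finset_eq`).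
* **`symm_binomial`** — for every symmetric multilinear `M` (any commutative semiring of scalars, any modules):
  `M(a + b, …, a + b) = Σ_{m=0}^{n} (n choose m) • M(splitVec m a b)` (Mathlib `MultilinearMap.map_add_univ` —
  the sum over all `s` — regrouped by `|s|` with `Finset.sum_powerset_apply_card`).
* **`eq41_iteratedFDeriv`** — the printed instance: for `f` analytic at `x` (`ContDiffAt 𝕜 ω f x`; symmetry of
  `iteratedFDeriv 𝕜 n f x` is Mathlib `ContDiffAt.iteratedFDeriv_comp_perm`) and any `B₁, B₂`,
  `Dⁿf(x)(B₁ + B₂, …) = Σ_m (n choose m) • Dⁿf(x)(splitVec m B₁ B₂)`; **`eq41`** — with `B₁ = ζ B`,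
  `B₂ = B − ζ B` for a (continuous) linear «multiplication by ζ̃_□» operator `ζ`, literally (4.1):
  `Dⁿf(x)(B, …, B) = Σ_m (n choose m) • Dⁿf(x)((ζB)^{m}, ((1 − ζ)B)^{n−m})`.
The smallness statement «terms with m < n are exponentially small in L^jη» is (4.5) (rows `B12.Eq4.2-4.3`,
`B12.Eq4.5`: `B12Repr43`, `B12Ineq45`) and is not part of this file.  Axioms standard.
-/

namespace Literature.MathematicalPhysics.QuantumFieldTheory.Balaban1983to89.B12Localization41

open Finset

/-! ## 1. The argument vectors `(⊗^m a) ⊗ (⊗^{n−m} b)` -/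

section Vec

variable {E : Type*} {n : ℕ}

/-- The argument list `(a, …, a, b, …, b)` of an `n`-linear form with `m` copies of `a` first: the tensor
`(⊗^{m} a) ⊗ (⊗^{n−m} b)` of (4.1). [cite: Balaban1987RG1, (4.1) p.281] -/
def splitVec (m : ℕ) (a b : E) : Fin n → E := fun i => if (i : ℕ) < m then a else b

/-- `splitVec m a b` evaluated. [cite: Balaban1987RG1, (4.1) p.281] -/
@[simp] theorem splitVec_apply (m : ℕ) (a b : E) (i : Fin n) :
    splitVec m a b i = if (i : ℕ) < m then a else b := rfl

/-- `splitVec m a b` is the `piecewise` vector of the initial segment `{i < m}`. [cite: Balaban1987RG1, (4.1) p.281] -/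
theorem splitVec_eq_piecewise (m : ℕ) (a b : E) :
    (splitVec m a b : Fin n → E) = (univ.filter (fun i : Fin n => (i : ℕ) < m)).piecewise (fun _ => a) (fun _ => b) := by
  funext i
  by_cases h : (i : ℕ) < m
  · rw [splitVec_apply, if_pos h, Finset.piecewise_eq_of_mem _ _ _ (by simpa using h)]
  · rw [splitVec_apply, if_neg h, Finset.piecewise_eq_of_notMem _ _ _ (by simpa using h)]

/-- With all `n` slots equal to `a`: `splitVec n a b = (a, …, a)`. [cite: Balaban1987RG1, (4.1) p.281] -/
theorem splitVec_self (a b : E) : (splitVec n a b : Fin n → E) = fun _ => a := by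
  funext i; simp [i.isLt]

/-- With no slot equal to `a`: `splitVec 0 a b = (b, …, b)`. [cite: Balaban1987RG1, (4.1) p.281] -/
theorem splitVec_zero (a b : E) : (splitVec 0 a b : Fin n → E) = fun _ => b := by
  funext i; simp

/-- For every subset `s` of the slots there is a permutation `σ` of the slots carrying the mixed argument
`s.piecewise a b` (value `a` on `s`, `b` off `s`) to the sorted one: `(s.piecewise a b) ∘ σ = splitVec |s| a b`
(a bijection `{i < |s|} → s` extended to a permutation, Mathlib `Equiv.Perm.exists_map_finset_eq`). [cite: Balaban1987RG1, (4.1) p.281] -/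
theorem piecewise_comp_perm_eq_splitVec (s : Finset (Fin n)) (a b : E) :
    ∃ σ : Equiv.Perm (Fin n), (s.piecewise (fun _ => a) (fun _ => b)) ∘ σ = splitVec s.card a b := by
  classical
  set t : Finset (Fin n) := univ.filter (fun i : Fin n => (i : ℕ) < s.card) with ht
  have htc : t.card = s.card := by
    rw [ht, Fin.card_filter_val_lt, min_eq_right (card_finset_fin_le s)]
  obtain ⟨σ, hσ⟩ := Equiv.Perm.exists_map_finset_eq t s htc
  refine ⟨σ, ?_⟩
  funext i
  have hmem : σ i ∈ s ↔ i ∈ t := by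
    rw [← hσ, Finset.mem_map_equiv, Equiv.symm_apply_apply]
  by_cases hi : i ∈ t
  · rw [Function.comp_apply, Finset.piecewise_eq_of_mem _ _ _ (hmem.2 hi), splitVec_eq_piecewise,
      Finset.piecewise_eq_of_mem _ _ _ hi]
  · rw [Function.comp_apply, Finset.piecewise_eq_of_notMem _ _ _ (fun h => hi (hmem.1 h)),
      splitVec_eq_piecewise, Finset.piecewise_eq_of_notMem _ _ _ hi]

end Vec

/-! ## 2. The binomial theorem for symmetric multilinear forms -/

section Algebra

variable {R : Type*} [CommSemiring R] {E F : Type*} [AddCommMonoid E] [AddCommMonoid F] [Module R E]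
  [Module R F] {n : ℕ}

/-- A symmetric `n`-linear form takes the same value on every mixed argument with `|s|` slots `a` and the
others `b`: `M(s.piecewise a b) = M(splitVec |s| a b)`. [cite: Balaban1987RG1, (4.1) p.281] -/
theorem symm_apply_piecewise (M : MultilinearMap R (fun _ : Fin n => E) F)
    (hM : ∀ (v : Fin n → E) (σ : Equiv.Perm (Fin n)), M (v ∘ σ) = M v) (s : Finset (Fin n)) (a b : E) :
    M (s.piecewise (fun _ => a) (fun _ => b)) = M (splitVec s.card a b) := by
  obtain ⟨σ, hσ⟩ := piecewise_comp_perm_eq_splitVec s a b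
  rw [← hσ, hM]

/-- **The binomial theorem for a SYMMETRIC `n`-linear form** (the algebra of (4.1)):
`M(a + b, …, a + b) = Σ_{m=0}^{n} (n choose m) • M((⊗^m a) ⊗ (⊗^{n−m} b))` — multilinearity gives the sum
over all `2ⁿ` subsets of slots (Mathlib `MultilinearMap.map_add_univ`), symmetry makes the summand depend on
`|s|` only, and there are `(n choose m)` subsets of size `m`. [cite: Balaban1987RG1, (4.1) p.281] -/
theorem symm_binomial (M : MultilinearMap R (fun _ : Fin n => E) F)
    (hM : ∀ (v : Fin n → E) (σ : Equiv.Perm (Fin n)), M (v ∘ σ) = M v) (a b : E) :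
    M (fun _ => a + b) = ∑ m ∈ range (n + 1), (n.choose m) • M (splitVec m a b) := by
  classical
  have h1 : M (fun _ => a + b) = ∑ s : Finset (Fin n), M (s.piecewise (fun _ => a) (fun _ => b)) :=
    M.map_add_univ (fun _ => a) (fun _ => b)
  rw [h1]
  simp_rw [symm_apply_piecewise M hM]
  rw [← Finset.powerset_univ, Finset.sum_powerset_apply_card (fun m => M (splitVec m a b)),
    Finset.card_univ, Fintype.card_fin]

/-- The two extreme terms of (4.1): `m = n` is `M(a, …, a)` and `m = 0` is `M(b, …, b)`; in the paper the
`m = n` term `⟨δⁿE, ⊗ⁿ ζ̃_□B⟩` is the one kept, the others (`m < n`) are «exponentially small in L^jη» by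
(4.5). [cite: Balaban1987RG1, (4.1) p.281] -/
theorem symm_binomial_split_last (M : MultilinearMap R (fun _ : Fin n => E) F)
    (hM : ∀ (v : Fin n → E) (σ : Equiv.Perm (Fin n)), M (v ∘ σ) = M v) (a b : E) :
    M (fun _ => a + b) = M (fun _ => a) + ∑ m ∈ range n, (n.choose m) • M (splitVec m a b) := by
  rw [symm_binomial M hM, Finset.sum_range_succ, Nat.choose_self, one_smul, splitVec_self, add_comm]

end Algebra

/-! ## 3. The printed instance: the `n`-th variational derivative of an analytic function -/

section Analytic

open scoped ContDiff

variable {𝕜 : Type*} [NontriviallyNormedField 𝕜] {E F : Type*} [NormedAddCommGroup E] [NormedSpace 𝕜 E]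
  [NormedAddCommGroup F] [NormedSpace 𝕜 F]

/-- **(4.1) for the `n`-th Fréchet derivative of an analytic function** `f` at `x` (the paper's
`B ↦ E^{(j)}(X, U_j(□₀, exp iB))` at `B = 0`, analytic by (3.36) ff.; symmetry of `Dⁿf(x)` is Mathlib
`ContDiffAt.iteratedFDeriv_comp_perm`): for every decomposition of the argument `B₁ + B₂`,
`Dⁿf(x)(B₁ + B₂, …, B₁ + B₂) = Σ_{m=0}^{n} (n choose m) • Dⁿf(x)((⊗^m B₁) ⊗ (⊗^{n−m} B₂))`. [cite: Balaban1987RG1, (4.1) p.281] -/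
theorem eq41_iteratedFDeriv {f : E → F} {x : E} (hf : ContDiffAt 𝕜 ω f x) (n : ℕ) (B₁ B₂ : E) :
    iteratedFDeriv 𝕜 n f x (fun _ => B₁ + B₂)
      = ∑ m ∈ range (n + 1), (n.choose m) • iteratedFDeriv 𝕜 n f x (splitVec m B₁ B₂) := by
  have h := symm_binomial (iteratedFDeriv 𝕜 n f x).toMultilinearMap
    (fun v σ => hf.iteratedFDeriv_comp_perm v σ) B₁ B₂
  simpa only [ContinuousMultilinearMap.coe_coe] using h

/-- **(4.1) as printed**: with the localising operator `ζ` («multiplication by ζ̃_□», any continuous linear map)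
and `B = ζB + (1 − ζ)B`,
`⟨Dⁿf(x), ⊗ⁿB⟩ = Σ_{m=0}^{n} (n choose m) ⟨Dⁿf(x), (⊗^m ζB) ⊗ (⊗^{n−m} (1 − ζ)B)⟩`. [cite: Balaban1987RG1, (4.1) p.281] -/
theorem eq41 {f : E → F} {x : E} (hf : ContDiffAt 𝕜 ω f x) (n : ℕ) (ζ : E →L[𝕜] E) (B : E) :
    iteratedFDeriv 𝕜 n f x (fun _ => B)
      = ∑ m ∈ range (n + 1), (n.choose m) • iteratedFDeriv 𝕜 n f x (splitVec m (ζ B) ((1 - ζ) B)) := by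
  have hB : (fun _ : Fin n => B) = fun _ => ζ B + (1 - ζ) B := by
    funext; simp
  rw [hB]
  exact eq41_iteratedFDeriv hf n (ζ B) ((1 - ζ) B)

/-- The kept term of (4.1): `⟨Dⁿf(x), ⊗ⁿB⟩ = ⟨Dⁿf(x), ⊗ⁿ ζB⟩ + Σ_{m<n} (n choose m) ⟨Dⁿf(x), (⊗^m ζB) ⊗ (⊗^{n−m}(1−ζ)B)⟩`
(the `m < n` remainder is the object of (4.5)). [cite: Balaban1987RG1, (4.1) p.281] -/
theorem eq41_split_last {f : E → F} {x : E} (hf : ContDiffAt 𝕜 ω f x) (n : ℕ) (ζ : E →L[𝕜] E) (B : E) :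
    iteratedFDeriv 𝕜 n f x (fun _ => B)
      = iteratedFDeriv 𝕜 n f x (fun _ => ζ B)
        + ∑ m ∈ range n, (n.choose m) • iteratedFDeriv 𝕜 n f x (splitVec m (ζ B) ((1 - ζ) B)) := by
  rw [eq41 hf n ζ B, Finset.sum_range_succ, Nat.choose_self, one_smul, splitVec_self, add_comm]

end Analytic

end Literature.MathematicalPhysics.QuantumFieldTheory.Balaban1983to89.B12Localization41
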